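import Summits.ResolutionOfSingularities.KangarooAtlas.MizutaniRationalExponent
import Summits.ResolutionOfSingularities.KangarooAtlas.MizutaniSeparablePoints
import HarnessLib

/-!
# An intrinsic upper bound for the exponent of the Hironaka scheme of an arbitrary point

Cell `pub-rosobs`, Mizutani enclosure (seat mizutani-encloser-1, gen 8).  AI-written; *AI review is weaker than
expert review*; NOT a resolution-of-singularities theorem (summit relevance C).

For a point `𝔭` of `ℙ^n_k` (any homogeneous prime; `ξ_i` the classes of `X_i` in `S/𝔭`) put
`W_j = span_k {ξ_0^{p^j}, …, ξ_n^{p^j}} ⊂ S/𝔭` and `cdim_j = dim_k W_j` (`MizutaniInvFormsTensor.cdim`).  Since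
`(Σ μ_i ξ_i^{p^j})^p = Σ μ_i^p ξ_i^{p^{j+1}}`, `W_{j+1}` is spanned by the `p`-th powers of any basis of `W_j`, so
`cdim_{j+1} ≤ cdim_j` (`cdim_succ_le`).  T. Oda (Publ. RIMS 19 (1983), Thm. 3.1 with Cor. 2.3) describes `B(𝔭)` as
`Φ^{(1)}(L_0, φ)` for the evaluation `φ : X_i ↦ ξ_i`, «of exponent `≤ e` iff `φ` can be taken over `F^{−e}(k)`».
Read intrinsically, one level at a time: if `cdim_{e'} = cdim_{e'+1}`, the `p`-th powers `(m'_j)^p` of a `k`-basis of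
`W_{e'}` form a basis of `W_{e'+1}` in which the coordinates of the `ξ_i^{p^{e'+1}}` are `p`-th POWERS `c'_{ij}^p`; the
tensors `Σ_i a_i ⊗ c'_{ij}^p` of an invariant form `a ∈ (L_B)_{e'+1}` are then SPLIT
(`sum_tmul_pow_mem_frobIdeal_pow`, `MizutaniRationalExponent.lean`), and the HEART `mem_span_frobVec_of_rho_mem_split`
(`MizutaniInvFormsSplit.lean`) gives `a ∈ k·F (L_B)_{e'}`:

* **`invForms_succ_eq_of_cdim_eq`** — `cdim_{e'}(𝔭) = cdim_{e'+1}(𝔭) ⇒ (L_B)_{e'+1}(𝔭) = k·F (L_B)_{e'}(𝔭)`;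
* **`exponentLE_of_cdim_eq`** — if `cdim_j(𝔭)` is constant for `j ≥ e` then `ExponentLE k p 𝔭 e`: **the exponent of
  `B(𝔭)` is at most the level at which the dimensions `dim_k span_k{ξ_i^{p^j}}` stabilise** (they do stabilise:
  `cdim_succ_le`, `cdim_pos`); `exponent_le_of_cdim_eq`.
* `cdim_ratPoint_eq_one` — at a `k^{1/q}`-rational point `cdim_j = 1` for all `j ≥ e`, which recovers
  `exponentLE_ratPoint` (`exponentLE_ratPoint'`); `cdim_eq_of_linearIndependent_pow` — at a point with separable residue
  field (Mac Lane's condition) `cdim_j` is constant, which recovers `exponentLE_zero_of_linearIndependent_pow`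
  (`MizutaniSeparablePoints.lean`) as `exponentLE_zero_of_linearIndependent_pow'`.  So both previously known classes of
  points with an exponent bound are instances of one criterion.

The bound is not sharp in general (the inseparable point `X_1^p = aX_0^p` of `ℙ¹` has `cdim_0 = 2 > cdim_1 = 1` but
exponent `0`, `MizutaniExamplesInseparable`); it is attained by Mizutani's `H_e` (`GenAtt.exponent_attP`).

## References

* T. Oda, *Hironaka's additive group scheme, II*, Publ. RIMS Kyoto Univ. 19 (1983) 1163–1179, Cor. 2.3 (p. 1171),
  Thm. 3.1 (p. 1173). [Oda1983HironakaGroupSchemeII]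
* H. Mizutani, *Hironaka's additive group schemes*, Nagoya Math. J. 52 (1973) 85–95, §1 (*) and (c), Lemma 2.4.
  [Mizutani1973HironakaGroupSchemes]
-/

noncomputable section

open MvPolynomial TensorProduct Literature.AlgebraicGeometry.Resolution
  Literature.AlgebraicGeometry.Resolution.HironakaScheme

namespace Summit.ResolutionOfSingularities.KangarooAtlas.Mizutani

universe u

section CDim

variable (k : Type u) [Field k] (p : ℕ) [hp : Fact p.Prime] [CharP k p] {n : ℕ}
  (𝔭 : Ideal (MvPolynomial (Fin (n + 1)) k))

/-- **`w ∈ W_e ⇒ w^p ∈ W_{e+1}`** (`(Σ μ_i ξ_i^{p^e})^p = Σ μ_i^p ξ_i^{p^{e+1}}`). [cite: Oda1983HironakaGroupSchemeII, §2 (p. 1168: F the p-th power map)] -/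
theorem pow_mem_powSpan_succ [𝔭.IsPrime] (e : ℕ) {w : MvPolynomial (Fin (n + 1)) k ⧸ 𝔭} (hw : w ∈ powSpan k p 𝔭 e) :
    w ^ p ∈ powSpan k p 𝔭 (e + 1) := by
  haveI : CharP (MvPolynomial (Fin (n + 1)) k ⧸ 𝔭) p := charP_quotient
  induction hw using Submodule.span_induction with
  | mem x hx =>
    obtain ⟨i, rfl⟩ := hx
    refine Submodule.subset_span ⟨i, ?_⟩
    simp only [← pow_mul, pow_succ]
  | zero => rw [zero_pow hp.out.ne_zero]; exact Submodule.zero_mem _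
  | add x y _ _ hx hy => rw [add_pow_char]; exact Submodule.add_mem _ hx hy
  | smul c x _ hx => rw [smul_pow]; exact Submodule.smul_mem _ _ hx

/-- **`ξ_i^{p^{e+1}} = Σ_j c_{ij}^p (m_j)^p`**: at the next level, the coordinates in the `p`-th powers of a basis of `W_e`
are the `p`-th powers of the coordinates. [cite: Oda1983HironakaGroupSchemeII, Thm. 3.1 (p. 1173: φ and its coordinates)] -/
theorem xi_pow_succ_eq_sum [𝔭.IsPrime] (e : ℕ) (i : Fin (n + 1)) :
    xi k 𝔭 i ^ p ^ (e + 1) = ∑ j, coord k p 𝔭 e i j ^ p •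
      ((cbasis k p 𝔭 e j : powSpan k p 𝔭 e) : MvPolynomial (Fin (n + 1)) k ⧸ 𝔭) ^ p := by
  haveI : CharP (MvPolynomial (Fin (n + 1)) k ⧸ 𝔭) p := charP_quotient
  rw [pow_succ, pow_mul, xi_pow_eq_sum k p 𝔭 e i, sum_pow_char]
  exact Finset.sum_congr rfl fun j _ => by rw [smul_pow]

/-- **`W_{e+1}` is spanned by the `p`-th powers of a basis of `W_e`.** [cite: Oda1983HironakaGroupSchemeII, §2 (p. 1168: F the p-th power map)] -/
theorem powSpan_succ_eq_span_pow [𝔭.IsPrime] (e : ℕ) :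
    powSpan k p 𝔭 (e + 1) = Submodule.span k (Set.range fun j : Fin (cdim k p 𝔭 e) =>
      ((cbasis k p 𝔭 e j : powSpan k p 𝔭 e) : MvPolynomial (Fin (n + 1)) k ⧸ 𝔭) ^ p) := by
  apply le_antisymm
  · change Submodule.span k (Set.range fun i : Fin (n + 1) => xi k 𝔭 i ^ p ^ (e + 1)) ≤ _
    rw [Submodule.span_le]
    rintro _ ⟨i, rfl⟩
    show xi k 𝔭 i ^ p ^ (e + 1) ∈ _
    rw [SetLike.mem_coe, xi_pow_succ_eq_sum]
    exact Submodule.sum_mem _ fun j _ => Submodule.smul_mem _ _ (Submodule.subset_span ⟨j, rfl⟩)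
  · rw [Submodule.span_le]
    rintro _ ⟨j, rfl⟩
    exact pow_mem_powSpan_succ k p 𝔭 e (cbasis k p 𝔭 e j).2

/-- **`cdim_{e+1} ≤ cdim_e`**: the dimensions `dim_k span_k{ξ_i^{p^j}}` are non-increasing in the level.
[cite: Oda1983HironakaGroupSchemeII, §2 (p. 1168)] -/
theorem cdim_succ_le [𝔭.IsPrime] (e : ℕ) : cdim k p 𝔭 (e + 1) ≤ cdim k p 𝔭 e := by
  have h : Module.finrank k (Submodule.span k (Set.range fun j : Fin (cdim k p 𝔭 e) =>
      ((cbasis k p 𝔭 e j : powSpan k p 𝔭 e) : MvPolynomial (Fin (n + 1)) k ⧸ 𝔭) ^ p)) ≤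
      Fintype.card (Fin (cdim k p 𝔭 e)) := finrank_range_le_card (R := k) _
  rw [Fintype.card_fin, ← powSpan_succ_eq_span_pow] at h
  exact h

/-- `cdim_{e+m} ≤ cdim_e`. [folklore] -/
theorem cdim_add_le [𝔭.IsPrime] (e m : ℕ) : cdim k p 𝔭 (e + m) ≤ cdim k p 𝔭 e := by
  induction m with
  | zero => exact le_rfl
  | succ m ih => exact (cdim_succ_le k p 𝔭 (e + m)).trans ih

omit hp [CharP k p] in
/-- `cdim_e ≥ 1` for a point of `ℙ^n` (some `X_i ∉ 𝔭`, and `S/𝔭` is a domain). [folklore] -/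
theorem cdim_pos (hP : IsPoint k 𝔭) (e : ℕ) : 0 < cdim k p 𝔭 e := by
  haveI := hP.1
  obtain ⟨i, hi⟩ : ∃ i, (X i : MvPolynomial (Fin (n + 1)) k) ∉ 𝔭 := by
    by_contra h
    push Not at h
    exact hP.2.2 (irrelevant_le_of_X_mem (k := k) h)
  have hne : xi k 𝔭 i ^ p ^ e ≠ 0 := by
    refine pow_ne_zero _ ?_
    unfold xi
    rwa [Ne, Ideal.Quotient.eq_zero_iff_mem]
  have hle : Submodule.span k {xi k 𝔭 i ^ p ^ e} ≤ powSpan k p 𝔭 e := by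
    rw [Submodule.span_le, Set.singleton_subset_iff]
    exact Submodule.subset_span ⟨i, rfl⟩
  have h1 := finrank_span_singleton (K := k) hne
  have hmono := Submodule.finrank_mono hle
  unfold cdim
  omega

/-! ### Equal dimensions: a basis with `p`-th-power coordinates, split tensors, the HEART -/

/-- Change of basis for the tensors `Σ_i a_i ⊗ (B.repr ξ_i^{p^E})_j`: if they lie in an ideal for one basis of `W_E`,
they lie in it for every basis. [folklore] -/
theorem sum_tmul_repr_mem_of_forall {E : ℕ} {ι₁ ι₂ : Type*} [Fintype ι₁] [Fintype ι₂]
    (B₁ : Module.Basis ι₁ k (powSpan k p 𝔭 E)) (B₂ : Module.Basis ι₂ k (powSpan k p 𝔭 E))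
    (I : Ideal (k ⊗[frobPow k p E] k)) (a : Fin (n + 1) → k)
    (h : ∀ l, (∑ i, a i ⊗ₜ[frobPow k p E] B₂.repr (xiPow k p 𝔭 E i) l) ∈ I) (j : ι₁) :
    (∑ i, a i ⊗ₜ[frobPow k p E] B₁.repr (xiPow k p 𝔭 E i) j) ∈ I := by
  -- `B₁.repr x j = Σ_l B₁.repr (B₂ l) j · B₂.repr x l`
  have hrepr : ∀ i, B₁.repr (xiPow k p 𝔭 E i) j = ∑ l, B₁.repr (B₂ l) j * B₂.repr (xiPow k p 𝔭 E i) l :=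
    fun i => (B₁.sum_repr_mul_repr B₂ (xiPow k p 𝔭 E i) j).symm
  have heq : (∑ i, a i ⊗ₜ[frobPow k p E] B₁.repr (xiPow k p 𝔭 E i) j) =
      ∑ l, (∑ i, a i ⊗ₜ[frobPow k p E] B₂.repr (xiPow k p 𝔭 E i) l) *
        ((1 : k) ⊗ₜ[frobPow k p E] B₁.repr (B₂ l) j) := by
    calc (∑ i, a i ⊗ₜ[frobPow k p E] B₁.repr (xiPow k p 𝔭 E i) j)
        = ∑ i, ∑ l, (a i ⊗ₜ[frobPow k p E] B₂.repr (xiPow k p 𝔭 E i) l) *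
            ((1 : k) ⊗ₜ[frobPow k p E] B₁.repr (B₂ l) j) := by
          refine Finset.sum_congr rfl fun i _ => ?_
          rw [hrepr i, TensorProduct.tmul_sum]
          refine Finset.sum_congr rfl fun l _ => ?_
          rw [Algebra.TensorProduct.tmul_mul_tmul, mul_one, mul_comm]
      _ = _ := by rw [Finset.sum_comm]; exact Finset.sum_congr rfl fun l _ => (Finset.sum_mul _ _ _).symm
  rw [heq]
  exact I.sum_mem fun l _ => I.mul_mem_right _ (h l)

/-- **`cdim_e(𝔭) = cdim_{e+1}(𝔭) ⇒ (L_B)_{e+1}(𝔭) ⊆ k·F (L_B)_e(𝔭)`**: when the dimensions agree, the `p`-th powers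
`(m_j)^p` of the basis of `W_e` form a BASIS of `W_{e+1}` in which the coordinates of `ξ_i^{p^{e+1}}` are `c_{ij}^p`; the
tensors `Σ_i a_i ⊗ c_{ij}^p` of an invariant form `a` are split (`sum_tmul_pow_mem_frobIdeal_pow`), hence so are the
`rho j a` (change of basis), and the HEART applies. [cite: Oda1983HironakaGroupSchemeII, Cor. 2.3 (p. 1171: "exponent(B) ≤ e iff V is defined over F^{-e}(k)") and Thm. 3.1 (p. 1173: "iff φ can be taken over F^{-e}(k)")] -/
theorem invForms_succ_le_of_cdim_eq [𝔭.IsPrime] (e : ℕ) (h : cdim k p 𝔭 e = cdim k p 𝔭 (e + 1)) :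
    invForms k p 𝔭 (e + 1) ≤
      Submodule.span k (frobVec k p 1 '' (invForms k p 𝔭 e : Set (Fin (n + 1) → k))) := by
  -- the family `(m_j)^p` in `W_{e+1}`
  set f : Fin (cdim k p 𝔭 e) → powSpan k p 𝔭 (e + 1) := fun j =>
    ⟨((cbasis k p 𝔭 e j : powSpan k p 𝔭 e) : MvPolynomial (Fin (n + 1)) k ⧸ 𝔭) ^ p,
      pow_mem_powSpan_succ k p 𝔭 e (cbasis k p 𝔭 e j).2⟩ with hf
  have hxf : ∀ i, xiPow k p 𝔭 (e + 1) i = ∑ j, coord k p 𝔭 e i j ^ p • f j := by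
    intro i
    apply Subtype.ext
    rw [Submodule.coe_sum]
    exact xi_pow_succ_eq_sum k p 𝔭 e i
  -- it spans `W_{e+1}`
  have hsp : ⊤ ≤ Submodule.span k (Set.range f) := by
    have htop : (⊤ : Submodule k (powSpan k p 𝔭 (e + 1))) =
        Submodule.span k (((↑) : powSpan k p 𝔭 (e + 1) → MvPolynomial (Fin (n + 1)) k ⧸ 𝔭) ⁻¹'
          Set.range fun i : Fin (n + 1) => xi k 𝔭 i ^ p ^ (e + 1)) :=
      (Submodule.span_span_coe_preimage).symm
    rw [htop, Submodule.span_le]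
    rintro w ⟨i, hi⟩
    have hw : w = xiPow k p 𝔭 (e + 1) i := Subtype.ext hi.symm
    rw [SetLike.mem_coe, hw, hxf i]
    exact Submodule.sum_mem _ fun j _ => Submodule.smul_mem _ _ (Submodule.subset_span ⟨j, rfl⟩)
  -- and has the right cardinality, hence is a basis
  have hli : LinearIndependent k f :=
    linearIndependent_of_top_le_span_of_card_eq_finrank hsp (by rw [Fintype.card_fin]; exact h)
  let B : Module.Basis (Fin (cdim k p 𝔭 e)) k (powSpan k p 𝔭 (e + 1)) := Module.Basis.mk hli hsp
  have hB : ∀ i j, B.repr (xiPow k p 𝔭 (e + 1) i) j = coord k p 𝔭 e i j ^ p := by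
    intro i j
    have hx : xiPow k p 𝔭 (e + 1) i = ∑ l, coord k p 𝔭 e i l ^ p • B l := by
      rw [hxf i]
      exact Finset.sum_congr rfl fun l _ => by rw [Module.Basis.mk_apply]
    rw [hx, ← B.equivFun_symm_apply, ← Module.Basis.equivFun_apply, LinearEquiv.apply_symm_apply]
  -- the HEART, fed with split tensors
  intro a ha
  refine mem_span_frobVec_of_rho_mem_split k p 𝔭 inferInstance e a fun j => ?_
  have hJ : ∀ l, rho k p 𝔭 (e + 1) l a ∈ KaehlerDifferential.ideal (frobPow k p (e + 1)) k ^ p ^ (e + 1) :=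
    (mem_invForms_iff_rho k p 𝔭 (e + 1) a).mp ha
  have hsplit : ∀ l, (∑ i, a i ⊗ₜ[frobPow k p (e + 1)] B.repr (xiPow k p 𝔭 (e + 1) i) l) ∈
      frobIdeal k p (frobPow k p (e + 1)) ^ p ^ e := by
    intro l
    have hJ' := sum_tmul_repr_mem_of_forall k p 𝔭 B (cbasis k p 𝔭 (e + 1)) _ a hJ l
    simp_rw [hB] at hJ' ⊢
    exact sum_tmul_pow_mem_frobIdeal_pow k p e a (fun i => coord k p 𝔭 e i l) hJ'
  exact sum_tmul_repr_mem_of_forall k p 𝔭 (cbasis k p 𝔭 (e + 1)) B _ a hsplit j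

/-- **`cdim_e(𝔭) = cdim_{e+1}(𝔭) ⇒ (L_B)_{e+1}(𝔭) = k·F (L_B)_e(𝔭)`.** [cite: Oda1983HironakaGroupSchemeII, Cor. 2.3 (p. 1171) and Thm. 3.1 (p. 1173)] -/
theorem invForms_succ_eq_of_cdim_eq [𝔭.IsPrime] (e : ℕ) (h : cdim k p 𝔭 e = cdim k p 𝔭 (e + 1)) :
    invForms k p 𝔭 (e + 1) =
      Submodule.span k (frobVec k p 1 '' (invForms k p 𝔭 e : Set (Fin (n + 1) → k))) :=
  le_antisymm (invForms_succ_le_of_cdim_eq k p 𝔭 e h)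
    (span_frobVec_image_le k p 𝔭 (Ideal.IsPrime.ne_top inferInstance) e)

/-- **AN UPPER BOUND FOR THE EXPONENT OF AN ARBITRARY POINT**: if the dimensions `cdim_j(𝔭) = dim_k span_k{ξ_i^{p^j}}`
are constant for `j ≥ e`, then `B(𝔭)` has exponent `≤ e` (`ExponentLE k p 𝔭 e`).  Contains `exponentLE_ratPoint`
(`cdim_j = 1` for `j ≥ e` at a `k^{1/q}`-rational point, `exponentLE_ratPoint'` below) and the separable points
(`cdim_j` constant under Mac Lane's condition, `exponentLE_zero_of_linearIndependent_pow'` below).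
AI-written; *AI review is weaker than expert review*; not a resolution theorem.
[cite: Oda1983HironakaGroupSchemeII, Cor. 2.3 (p. 1171) and Thm. 3.1 (p. 1173); Mizutani1973HironakaGroupSchemes, §1 (*) and (c)] -/
theorem exponentLE_of_cdim_eq [𝔭.IsPrime] (e : ℕ) (h : ∀ m, cdim k p 𝔭 (e + m) = cdim k p 𝔭 e) :
    ExponentLE k p 𝔭 e := by
  have hstep : ∀ m, invForms k p 𝔭 (e + m + 1) =
      Submodule.span k (frobVec k p 1 '' (invForms k p 𝔭 (e + m) : Set (Fin (n + 1) → k))) := fun m =>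
    invForms_succ_eq_of_cdim_eq k p 𝔭 (e + m) (by rw [h m, Nat.add_assoc, h (m + 1)])
  have hall : ∀ m, invForms k p 𝔭 (e + m) =
      Submodule.span k (frobVec k p m '' (invForms k p 𝔭 e : Set (Fin (n + 1) → k))) := by
    intro m
    induction m with
    | zero =>
      have hid : frobVec k p 0 '' (invForms k p 𝔭 e : Set (Fin (n + 1) → k)) = invForms k p 𝔭 e := by
        have : frobVec k p 0 = (id : (Fin (n + 1) → k) → (Fin (n + 1) → k)) := funext (frobVec_zero k p)
        rw [this, Set.image_id]
      rw [hid, Submodule.span_eq]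
      rfl
    | succ m ih =>
      show invForms k p 𝔭 (e + m + 1) = _
      rw [hstep m, ih, span_image_frobVec_span, Set.image_image]
      congr 1
      exact Set.image_congr' fun v => frobVec_frobVec (k := k) (p := p) 1 m v
  intro j hj
  obtain ⟨m, rfl⟩ := Nat.exists_eq_add_of_le hj
  rw [Nat.add_sub_cancel_left]
  exact hall m

/-- **`exponent B(𝔭) ≤ e` as soon as `cdim_j(𝔭)` is constant for `j ≥ e`.** [cite: Oda1983HironakaGroupSchemeII, Cor. 2.3 (p. 1171)] -/
theorem exponent_le_of_cdim_eq [𝔭.IsPrime] (e : ℕ) (h : ∀ m, cdim k p 𝔭 (e + m) = cdim k p 𝔭 e) :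
    exponent k p 𝔭 ≤ e :=
  (exponent_le_iff k p 𝔭).mpr (exponentLE_of_cdim_eq k p 𝔭 e h)

/-- The dimensions `cdim_j` stabilise: some level `e` has `cdim_j` constant for `j ≥ e` — whence a finite exponent
`≤ e` (compare `exists_exponentLE`). [cite: Oda1983HironakaGroupSchemeII, §2 (p. 1168)] -/
theorem exists_cdim_eq [𝔭.IsPrime] : ∃ e, ∀ m, cdim k p 𝔭 (e + m) = cdim k p 𝔭 e := by
  classical
  -- the least value of the non-increasing sequence `cdim` and a level where it is attained
  have hex : ∃ v, ∃ e, cdim k p 𝔭 e = v := ⟨_, 0, rfl⟩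
  obtain ⟨e₀, he₀⟩ : ∃ e, cdim k p 𝔭 e = Nat.find hex := Nat.find_spec hex
  have hmin : ∀ e, Nat.find hex ≤ cdim k p 𝔭 e := fun e => by
    by_contra hlt
    exact Nat.find_min hex (not_le.mp hlt) ⟨e, rfl⟩
  refine ⟨e₀, fun m => le_antisymm (cdim_add_le k p 𝔭 e₀ m) ?_⟩
  rw [he₀]
  exact hmin (e₀ + m)

/-- **Every point has exponent at most its `cdim`-stabilisation level** (a second proof of `exists_exponentLE` for points,
with the bound made explicit). [cite: Oda1983HironakaGroupSchemeII, Cor. 2.3 (p. 1171)] -/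
theorem exists_exponent_le_of_cdim [𝔭.IsPrime] : ∃ e, (∀ m, cdim k p 𝔭 (e + m) = cdim k p 𝔭 e) ∧ exponent k p 𝔭 ≤ e := by
  obtain ⟨e, he⟩ := exists_cdim_eq k p 𝔭
  exact ⟨e, he, exponent_le_of_cdim_eq k p 𝔭 e he⟩

/-! ### Separable points again: `cdim` is constant under Mac Lane's condition -/

/-- Under Mac Lane's condition (`k`-independent families of `S/𝔭` have independent `p`-th powers — a separable residue
field), `cdim_m(𝔭) = cdim_0(𝔭)` for every `m` (`finrank_span_range_pow_eq`, `MizutaniSeparablePoints`).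
[cite: StacksProject, Tag 030W (2)] -/
theorem cdim_eq_of_linearIndependent_pow [𝔭.IsPrime]
    (hsep : ∀ (r : ℕ) (v : Fin r → MvPolynomial (Fin (n + 1)) k ⧸ 𝔭),
      LinearIndependent k v → LinearIndependent k fun i => v i ^ p)
    (m : ℕ) : cdim k p 𝔭 m = cdim k p 𝔭 0 := by
  haveI : CharP (MvPolynomial (Fin (n + 1)) k ⧸ 𝔭) p := charP_quotient
  have hsep' : ∀ (m r : ℕ) (v : Fin r → MvPolynomial (Fin (n + 1)) k ⧸ 𝔭),
      LinearIndependent k v → LinearIndependent k fun i => v i ^ p ^ m := by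
    intro m
    induction m with
    | zero => intro r v hv; simpa using hv
    | succ m ih =>
      intro r v hv
      have h := hsep r _ (ih r v hv)
      simpa only [← pow_mul, ← pow_succ] using h
  have h0 : (fun i : Fin (n + 1) => xi k 𝔭 i ^ p ^ 0) = xi k 𝔭 := by
    funext i; rw [pow_zero, pow_one]
  unfold cdim powSpan
  rw [finrank_span_range_pow_eq p (xi k 𝔭) m (hsep' m), h0]

/-- … so the criterion gives exponent `0` at separable points — a second proof of
`exponentLE_zero_of_linearIndependent_pow` (`MizutaniSeparablePoints`). [cite: Mizutani1973HironakaGroupSchemes, Remark 1.2; StacksProject Tag 030W] -/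
theorem exponentLE_zero_of_linearIndependent_pow' [𝔭.IsPrime]
    (hsep : ∀ (r : ℕ) (v : Fin r → MvPolynomial (Fin (n + 1)) k ⧸ 𝔭),
      LinearIndependent k v → LinearIndependent k fun i => v i ^ p) :
    ExponentLE k p 𝔭 0 :=
  exponentLE_of_cdim_eq k p 𝔭 0 fun m => by
    rw [Nat.zero_add]
    exact cdim_eq_of_linearIndependent_pow k p 𝔭 hsep m

end CDim

/-! ## `k^{1/q}`-rational points again: `cdim_j = 1` for `j ≥ e` -/

section RatPoint

variable (k : Type u) [Field k] (p e : ℕ) [hp : Fact p.Prime] [CharP k p] {n : ℕ} (c : Fin (n + 1) → k)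

/-- `Σ_l (single i t)_l • v_l = t • v_i`. [folklore] -/
theorem sum_single_smul {M : Type*} [AddCommMonoid M] [Module k M] (v : Fin (n + 1) → M) (i : Fin (n + 1)) (t : k) :
    ∑ l, (Pi.single (M := fun _ => k) i t l) • v l = t • v i := by
  classical
  rw [Finset.sum_eq_single i (fun l _ hl => by rw [Pi.single_eq_of_ne hl, zero_smul])
    (fun hi => absurd (Finset.mem_univ i) hi), Pi.single_eq_same]

/-- At `𝔭 = [c^{1/q}]` (`c ≠ 0`), `W_{e+m} = span_k{ξ_i^{p^{e+m}}}` is a LINE: `c_{i₀}^{p^m} ξ_i^{p^{e+m}} = c_i^{p^m} ξ_{i₀}^{p^{e+m}}`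
(the additive form `c_{i₀}^{p^m} X_i^{p^{e+m}} − c_i^{p^m} X_{i₀}^{p^{e+m}}` lies in the point, `addForm_mem_ratPoint_iff`).
[cite: Oda1983HironakaGroupSchemeII, Thm. 3.1 (p. 1173)] -/
theorem cdim_ratPoint_eq_one (hc : c ≠ 0) (m : ℕ) : cdim k p (ratPoint k p e c) (e + m) = 1 := by
  classical
  haveI := (ratPoint_isPrime (k := k) (p := p) (e := e) (c := c))
  obtain ⟨i₀, hi₀⟩ : ∃ i, c i ≠ 0 := by
    by_contra h
    push Not at h
    exact hc (funext h)
  have hq : c i₀ ^ p ^ m ≠ 0 := pow_ne_zero _ hi₀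
  -- the relation `c_{i₀}^{p^m} ξ_i^{p^{e+m}} = c_i^{p^m} ξ_{i₀}^{p^{e+m}}`
  have hrel : ∀ i, (c i₀ ^ p ^ m) • xi k (ratPoint k p e c) i ^ p ^ (e + m) =
      (c i ^ p ^ m) • xi k (ratPoint k p e c) i₀ ^ p ^ (e + m) := by
    intro i
    set g : Fin (n + 1) → k := Pi.single (M := fun _ => k) i (c i₀ ^ p ^ m) -
      Pi.single (M := fun _ => k) i₀ (c i ^ p ^ m) with hg
    have hmem : addForm k p (e + m) g ∈ ratPoint k p e c := by
      rw [addForm_mem_ratPoint_iff, hg]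
      simp only [Pi.sub_apply, sub_mul, Finset.sum_sub_distrib]
      rw [show (∑ l, Pi.single (M := fun _ => k) i (c i₀ ^ p ^ m) l * c l ^ p ^ m) = c i₀ ^ p ^ m * c i ^ p ^ m from
          sum_single_smul k (fun l => c l ^ p ^ m) i _,
        show (∑ l, Pi.single (M := fun _ => k) i₀ (c i ^ p ^ m) l * c l ^ p ^ m) = c i ^ p ^ m * c i₀ ^ p ^ m from
          sum_single_smul k (fun l => c l ^ p ^ m) i₀ _]
      ring
    have h0 := (Ideal.Quotient.eq_zero_iff_mem).mpr hmem
    unfold addForm at h0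
    rw [map_sum] at h0
    have hterm : ∀ l, Ideal.Quotient.mk (ratPoint k p e c) (C (g l) * X l ^ p ^ (e + m)) =
        g l • xi k (ratPoint k p e c) l ^ p ^ (e + m) := by
      intro l
      rw [map_mul, map_pow]
      exact (Algebra.smul_def (g l) (xi k (ratPoint k p e c) l ^ p ^ (e + m))).symm
    simp_rw [hterm, hg, Pi.sub_apply, sub_smul, Finset.sum_sub_distrib, sum_single_smul] at h0
    exact sub_eq_zero.mp h0
  -- hence `W ≤ k ∙ ξ_{i₀}^{p^{e+m}}`
  have hle : powSpan k p (ratPoint k p e c) (e + m) ≤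
      Submodule.span k {xi k (ratPoint k p e c) i₀ ^ p ^ (e + m)} := by
    unfold powSpan
    rw [Submodule.span_le]
    rintro _ ⟨i, rfl⟩
    rw [SetLike.mem_coe, Submodule.mem_span_singleton]
    refine ⟨(c i₀ ^ p ^ m)⁻¹ * c i ^ p ^ m, ?_⟩
    rw [mul_smul, ← hrel i, smul_smul, inv_mul_cancel₀ hq, one_smul]
  have h1 : Module.finrank k (Submodule.span k {xi k (ratPoint k p e c) i₀ ^ p ^ (e + m)}) ≤ 1 := by
    have := finrank_span_le_card (R := k) ({xi k (ratPoint k p e c) i₀ ^ p ^ (e + m)} :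
      Set (MvPolynomial (Fin (n + 1)) k ⧸ ratPoint k p e c))
    simpa using this
  have hmono := Submodule.finrank_mono hle
  have hpos := cdim_pos k p (ratPoint k p e c) (isPoint_ratPoint hc) (e + m)
  unfold cdim at hpos ⊢
  omega

/-- `exponentLE_ratPoint` recovered from the general criterion. [cite: Oda1983HironakaGroupSchemeII, Cor. 2.3 (p. 1171)] -/
theorem exponentLE_ratPoint' (hc : c ≠ 0) : ExponentLE k p (ratPoint k p e c) e := by
  haveI := (ratPoint_isPrime (k := k) (p := p) (e := e) (c := c))
  refine exponentLE_of_cdim_eq k p (ratPoint k p e c) e fun m => ?_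
  have h0 := cdim_ratPoint_eq_one k p e c hc 0
  rw [Nat.add_zero] at h0
  rw [cdim_ratPoint_eq_one k p e c hc m, h0]

end RatPoint

end Summit.ResolutionOfSingularities.KangarooAtlas.Mizutani

end
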